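import Mathlib.Analysis.Complex.Basic
import Mathlib.Algebra.Order.Floor.Defs
import Mathlib.Data.Finset.Prod
import Literature.Probability.RandomPlanarGeometry.PlanarDomains
import HarnessLib

/-!
# Refinement of polyomino representations (crux `PolyominoGaussianLaw`, stmt-CriticalPhenomena-14337,
# route `CardyTensorRG`, line `registered`, skeleton v4: stub `stub_polyominoRefinement`)

A polyomino conformal rectangle given at lattice spacing `δ₀` — carrier = interior of a finite union
of closed `δ₀`-squares `[δ₀ p₁, δ₀ (p₁+1)] × [δ₀ p₂, δ₀ (p₂+1)]`, marks at `δ₀`-lattice points — is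
also a polyomino conformal rectangle at every finer spacing `δ₀ / q`, `q ≥ 1`: each closed
`δ₀`-square is the union of the `q²` closed `(δ₀/q)`-squares it contains, and a `δ₀`-lattice point
is a `(δ₀/q)`-lattice point. In the skeleton this reduces the limits along all blocking orbits
`δ₀/(q·2^k)` to the limits along the PURE DYADIC orbits `δ₀'·2^(−k)` of all representations
`(δ₀', s')` — the form in which a `2×2`-blocking tensor renormalisation delivers them.

Pure bookkeeping (floor arithmetic); no percolation.
-/

namespace Summit.CriticalPhenomena.CardyFormulaZ2.Cruxes.PolyominoGaussianLaw.Birth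

open Set

/-- One-dimensional subdivision: for `δ > 0`, `q ≥ 1`, `a : ℤ`, the interval `[δ a, δ (a+1)]` is the
union of the `q` intervals `[(δ/q)(q a + r), (δ/q)(q a + r + 1)]`, `r < q`. [folklore] -/
theorem mem_Icc_iff_exists_subinterval {δ : ℝ} (hδ : 0 < δ) {q : ℕ} (hq : 1 ≤ q) (a : ℤ) (x : ℝ) :
    (δ * (a : ℝ) ≤ x ∧ x ≤ δ * ((a : ℝ) + 1)) ↔
      ∃ r : ℕ, r < q ∧ δ / (q : ℝ) * (((q : ℤ) * a + r : ℤ) : ℝ) ≤ x ∧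
        x ≤ δ / (q : ℝ) * ((((q : ℤ) * a + r : ℤ) : ℝ) + 1) := by
  have hq0 : (0 : ℝ) < q := by exact_mod_cast hq
  have hδq : 0 < δ / (q : ℝ) := div_pos hδ hq0
  constructor
  · rintro ⟨h1, h2⟩
    -- position of `x` inside the big interval, in units of the small spacing
    set u : ℝ := x / (δ / (q : ℝ)) - (q : ℝ) * (a : ℝ) with hu
    have hu0 : 0 ≤ u := by
      rw [hu, sub_nonneg, le_div_iff₀ hδq]
      have : (q : ℝ) * (a : ℝ) * (δ / (q : ℝ)) = δ * (a : ℝ) := by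
        field_simp
      linarith
    have huq : u ≤ q := by
      rw [hu, sub_le_iff_le_add, div_le_iff₀ hδq]
      have : ((q : ℝ) + (q : ℝ) * (a : ℝ)) * (δ / (q : ℝ)) = δ * ((a : ℝ) + 1) := by
        field_simp
        ring
      linarith
    set r : ℕ := min (q - 1) ⌊u⌋₊ with hr
    have hrq : r < q := lt_of_le_of_lt (min_le_left _ _) (Nat.sub_lt hq one_pos)
    have hr_le : (r : ℝ) ≤ u := by
      have h3 : ((min (q - 1) ⌊u⌋₊ : ℕ) : ℝ) ≤ (⌊u⌋₊ : ℝ) := by exact_mod_cast min_le_right _ _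
      exact h3.trans (Nat.floor_le hu0)
    have hr_ge : u ≤ (r : ℝ) + 1 := by
      by_cases hcase : ⌊u⌋₊ ≤ q - 1
      · have : r = ⌊u⌋₊ := by rw [hr, min_eq_right hcase]
        rw [this]
        exact (Nat.lt_floor_add_one u).le
      · have : r = q - 1 := by rw [hr, min_eq_left (le_of_lt (not_le.1 hcase))]
        rw [this, Nat.cast_sub hq, Nat.cast_one, sub_add_cancel]
        exact huq
    have hx : x = δ / (q : ℝ) * (u + (q : ℝ) * (a : ℝ)) := by
      rw [hu, sub_add_cancel, mul_div_cancel₀ _ hδq.ne']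
    refine ⟨r, hrq, ?_, ?_⟩
    · rw [hx]
      apply mul_le_mul_of_nonneg_left _ hδq.le
      push_cast
      linarith
    · rw [hx]
      apply mul_le_mul_of_nonneg_left _ hδq.le
      push_cast
      linarith
  · rintro ⟨r, hrq, h1, h2⟩
    have hr1 : (r : ℝ) + 1 ≤ q := by exact_mod_cast hrq
    have hr0 : (0 : ℝ) ≤ r := Nat.cast_nonneg r
    constructor
    · refine le_trans ?_ h1
      push_cast
      rw [show δ / (q : ℝ) * ((q : ℝ) * (a : ℝ) + (r : ℝ)) = δ * (a : ℝ) + δ / (q : ℝ) * (r : ℝ) by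
        field_simp]
      have : 0 ≤ δ / (q : ℝ) * (r : ℝ) := mul_nonneg hδq.le hr0
      linarith
    · refine le_trans h2 ?_
      push_cast
      rw [show δ / (q : ℝ) * ((q : ℝ) * (a : ℝ) + (r : ℝ) + 1) = δ * (a : ℝ) + δ / (q : ℝ) * ((r : ℝ) + 1) by
        field_simp; ring]
      have : δ / (q : ℝ) * ((r : ℝ) + 1) ≤ δ / (q : ℝ) * (q : ℝ) := mul_le_mul_of_nonneg_left hr1 hδq.le
      rw [div_mul_cancel₀ _ hq0.ne'] at this
      linarith

/-- Two-dimensional subdivision: the closed `δ₀`-square at `p` is the union of its `q²` closed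
`(δ₀/q)`-sub-squares, indexed by `(q p₁ + r₁, q p₂ + r₂)`, `r₁, r₂ < q`. [folklore] -/
theorem square_eq_iUnion_subsquares {δ₀ : ℝ} (hδ₀ : 0 < δ₀) {q : ℕ} (hq : 1 ≤ q) (p : ℤ × ℤ) :
    {z : ℂ | δ₀ * (p.1 : ℝ) ≤ z.re ∧ z.re ≤ δ₀ * ((p.1 : ℝ) + 1) ∧ δ₀ * (p.2 : ℝ) ≤ z.im ∧
        z.im ≤ δ₀ * ((p.2 : ℝ) + 1)} =
      ⋃ p' ∈ ((Finset.range q ×ˢ Finset.range q).image fun r : ℕ × ℕ => ((q : ℤ) * p.1 + r.1, (q : ℤ) * p.2 + r.2)),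
        {z : ℂ | δ₀ / (q : ℝ) * (p'.1 : ℝ) ≤ z.re ∧
        z.re ≤ δ₀ / (q : ℝ) * ((p'.1 : ℝ) + 1) ∧ δ₀ / (q : ℝ) * (p'.2 : ℝ) ≤ z.im ∧
        z.im ≤ δ₀ / (q : ℝ) * ((p'.2 : ℝ) + 1)} := by
  ext z
  simp only [mem_setOf_eq, mem_iUnion, exists_prop]
  constructor
  · rintro ⟨h1, h2, h3, h4⟩
    obtain ⟨r₁, hr₁, g1, g2⟩ := (mem_Icc_iff_exists_subinterval hδ₀ hq p.1 z.re).1 ⟨h1, h2⟩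
    obtain ⟨r₂, hr₂, g3, g4⟩ := (mem_Icc_iff_exists_subinterval hδ₀ hq p.2 z.im).1 ⟨h3, h4⟩
    refine ⟨((q : ℤ) * p.1 + r₁, (q : ℤ) * p.2 + r₂), ?_, g1, g2, g3, g4⟩
    simp only [Finset.mem_image, Finset.mem_product, Finset.mem_range]
    exact ⟨(r₁, r₂), ⟨hr₁, hr₂⟩, rfl⟩
  · rintro ⟨p', hp', g1, g2, g3, g4⟩
    simp only [Finset.mem_image, Finset.mem_product, Finset.mem_range] at hp'
    obtain ⟨⟨r₁, r₂⟩, ⟨hr₁, hr₂⟩, rfl⟩ := hp'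
    obtain ⟨h1, h2⟩ := (mem_Icc_iff_exists_subinterval hδ₀ hq p.1 z.re).2 ⟨r₁, hr₁, g1, g2⟩
    obtain ⟨h3, h4⟩ := (mem_Icc_iff_exists_subinterval hδ₀ hq p.2 z.im).2 ⟨r₂, hr₂, g3, g4⟩
    exact ⟨h1, h2, h3, h4⟩

/-- stub (polyomino refinement; bookkeeping). A polyomino representation with lattice marks of a
conformal rectangle at spacing `δ₀` yields one at every spacing `δ₀ / q`, `q ≥ 1`: the carrier is the
interior of the union of the `(δ₀/q)`-sub-squares, and `δ₀`-lattice marks are `(δ₀/q)`-lattice marks. -/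
theorem stub_polyominoRefinement :
    ∀ R : Literature.Probability.RandomPlanarGeometry.ConformalRectangle, ∀ δ₀ : ℝ, 0 < δ₀ →
      (∃ s : Finset (ℤ × ℤ), R.carrier = interior (⋃ p ∈ s, {z : ℂ | δ₀ * (p.1 : ℝ) ≤ z.re ∧
        z.re ≤ δ₀ * ((p.1 : ℝ) + 1) ∧ δ₀ * (p.2 : ℝ) ≤ z.im ∧ z.im ≤ δ₀ * ((p.2 : ℝ) + 1)})) →
      (∀ i, ∃ m n : ℤ, R.pt i = (δ₀ : ℂ) * ((m : ℂ) + (n : ℂ) * Complex.I)) →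
      ∀ q : ℕ, 1 ≤ q →
        (∃ s : Finset (ℤ × ℤ), R.carrier = interior (⋃ p ∈ s, {z : ℂ |
          δ₀ / (q : ℝ) * (p.1 : ℝ) ≤ z.re ∧ z.re ≤ δ₀ / (q : ℝ) * ((p.1 : ℝ) + 1) ∧
          δ₀ / (q : ℝ) * (p.2 : ℝ) ≤ z.im ∧ z.im ≤ δ₀ / (q : ℝ) * ((p.2 : ℝ) + 1)})) ∧
        ∀ i, ∃ m n : ℤ, R.pt i = ((δ₀ / (q : ℝ) : ℝ) : ℂ) * ((m : ℂ) + (n : ℂ) * Complex.I) := by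
  intro R δ₀ hδ₀ hs hmarks q hq
  obtain ⟨s, hs⟩ := hs
  have hq0 : (q : ℝ) ≠ 0 := by
    have : (0 : ℝ) < q := by exact_mod_cast hq
    exact this.ne'
  refine ⟨⟨s.biUnion fun p => ((Finset.range q ×ˢ Finset.range q).image fun r : ℕ × ℕ => ((q : ℤ) * p.1 + r.1, (q : ℤ) * p.2 + r.2)), ?_⟩,
    fun i => ?_⟩
  · rw [hs]
    congr 1
    ext z
    simp only [mem_iUnion, Finset.mem_biUnion, exists_prop]
    constructor
    · rintro ⟨p, hp, hz⟩
      rw [square_eq_iUnion_subsquares hδ₀ hq p] at hz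
      simp only [mem_iUnion, exists_prop] at hz
      obtain ⟨p', hp', hz'⟩ := hz
      exact ⟨p', ⟨p, hp, hp'⟩, hz'⟩
    · rintro ⟨p', ⟨p, hp, hp'⟩, hz'⟩
      refine ⟨p, hp, ?_⟩
      rw [square_eq_iUnion_subsquares hδ₀ hq p]
      simp only [mem_iUnion, exists_prop]
      exact ⟨p', hp', hz'⟩
  · obtain ⟨m, n, h⟩ := hmarks i
    refine ⟨(q : ℤ) * m, (q : ℤ) * n, ?_⟩
    rw [h]
    have hq0' : (q : ℂ) ≠ 0 := by exact_mod_cast hq0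
    push_cast
    field_simp

end Summit.CriticalPhenomena.CardyFormulaZ2.Cruxes.PolyominoGaussianLaw.Birth
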